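import Mathlib
import Summits.KontsevichZagierPeriods.Zeta5Search.CatalanTwoAdicGenocchi
import HarnessLib

/-!
# Catalan box family — the inverse-factorial series `Σ a_n(x)` equals Beukers' `−Θ(x)` as a formal series in `1/x` (kernel K5b, step 2 of 3)

HONEST FRAMING: systematic search; no irrationality claim unless certified.

Cell `pub-zeta5`, seat `fam-catalan` (generation 4), successor project "kernel K5b" (`families/denom/K5B.md` §2, Lemma A).
Everything here is FORMAL, in `ℚ⟦X⟧` with `X = 1/x`; nothing 2-adic happens in this file.
* `σ : F(X) ↦ F(X/(1+X))` is the shift `x ↦ x+1` (`sig`, a `ℚ`-algebra endomorphism, via Mathlib's `PowerSeries.subst`);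
  its coefficient formula `coeff_sig` and the binomial expansion `coeff_sArg_pow_succ` of `(X/(1+X))^{n+1}`.
* `â_n = n!·X^{n+2}·g_n·∏_{i=1}^n g_i` (`g_i = 1/(1+iX)`) is the expansion of `a_n(x) = n!/((x)_{n+1}(x+n))`, the general term of
  the series whose value at `x = ½` is `t_μ/(μ+½)` (`CatalanTwoAdicXi.xiTerm`); the shift relation
  `â_{n+1} + σ(â_n) = X·(ê_n − ê_{n+1})` (`ê_n = n!·X^{n+1}·∏ g_i`) telescopes to `σÂ + Â = 2X²` for `Â := Σ_n â_n`
  (a coefficientwise-finite sum) — this is `A(x+1) + A(x) = 2/x²`.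
* `Φ := Σ_k G_k(−1)^{k+1}X^{k+1}` (Genocchi numbers) satisfies `σΦ + Φ = 2X²` by the Genocchi recurrence — this is Beukers'
  `Θ(x+1) + Θ(x) = −2/x²` for `Θ = −Φ`, [Be08, proof of Prop. 9] at `p = 2`.
* Beukers' Lemma 5 in formal dress: `σF + F = 0 ⇒ F = 0`; hence `Â = Φ` (`AHat_eq_Phi`, `sum_coeff_aHat`).
Step 3 (`CatalanTwoAdicTheta.lean`) specialises `X = 2` (i.e. `x = ½`) in `ℚ₂`.  0 sorry.
-/

open Finset PowerSeries Nat

noncomputable section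

namespace Summit.KontsevichZagierPeriods.Zeta5Search.CatalanTwoAdicFactorialSeries

open CatalanTwoAdicGenocchi (genocchi genocchi_recurrence)

/-! ### The geometric factors `g_i = 1/(1 + iX)` and the shift `σ` -/

/-- `g_i := Σ_m (−i)^m X^m`, the expansion of `1/(1 + iX) = x/(x + i)` in `X = 1/x`. -/
def geomInv (i : ℕ) : ℚ⟦X⟧ := mk fun m => (-(i : ℚ)) ^ m

/-- Coefficients of `g_i`. -/
@[simp] theorem coeff_geomInv (i m : ℕ) : coeff m (geomInv i) = (-(i : ℚ)) ^ m := coeff_mk _ _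

/-- `g_i` has constant term `1`. -/
theorem constantCoeff_geomInv (i : ℕ) : constantCoeff (geomInv i) = 1 := by
  rw [← coeff_zero_eq_constantCoeff_apply, coeff_geomInv, pow_zero]

/-- `g_0 = 1`. -/
theorem geomInv_zero : geomInv 0 = 1 := by
  ext m; simp [coeff_one, zero_pow_eq]

/-- Natural-number scalars in `ℚ⟦X⟧` are constants. -/
theorem natCast_eq_C (i : ℕ) : (i : ℚ⟦X⟧) = C (i : ℚ) := (map_natCast (C (R := ℚ)) i).symm

/-- `(1 + iX)·g_i = 1`. -/
theorem one_add_mul_geomInv (i : ℕ) : (1 + (i : ℚ⟦X⟧) * X) * geomInv i = 1 := by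
  ext m
  rw [add_mul, one_mul, map_add, natCast_eq_C, mul_assoc, coeff_C_mul]
  cases m with
  | zero => simp
  | succ m =>
    rw [coeff_succ_X_mul, coeff_geomInv, coeff_geomInv, coeff_one, if_neg (succ_ne_zero m), pow_succ]
    ring

/-- `(1 + X)·g_1 = 1`. -/
theorem one_add_X_mul_geomInv_one : (1 + X) * geomInv 1 = 1 := by
  simpa using one_add_mul_geomInv 1

/-- The substituted series `X·g₁ = X/(1+X)` (constant coefficient `0`). -/
def sArg : ℚ⟦X⟧ := X * geomInv 1

/-- `X/(1+X)` has no constant term. -/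
theorem constantCoeff_sArg : constantCoeff sArg = 0 := by simp [sArg]

/-- Hence it may be substituted into any power series. -/
theorem hasSubst_sArg : HasSubst sArg := HasSubst.of_constantCoeff_zero' constantCoeff_sArg

/-- `σ F := F(X/(1+X))`: in the variable `x = 1/X` this is the shift `F ↦ F(x+1)`; a `ℚ`-algebra endomorphism of `ℚ⟦X⟧`. -/
def sig : ℚ⟦X⟧ →ₐ[ℚ] ℚ⟦X⟧ := substAlgHom hasSubst_sArg

/-- `σ` is substitution of `X·g₁`. -/
theorem sig_apply (F : ℚ⟦X⟧) : sig F = F.subst sArg := by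
  show substAlgHom hasSubst_sArg F = _
  rw [coe_substAlgHom]

/-- `σ X = X·g₁`. -/
theorem sig_X : sig X = X * geomInv 1 := by
  rw [sig_apply, subst_X hasSubst_sArg, sArg]

/-- `[X^N] (X g₁)^d = 0` for `N < d`. -/
theorem coeff_sArg_pow_of_lt {d N : ℕ} (h : N < d) : coeff N (sArg ^ d) = 0 := by
  rw [sArg, mul_pow, coeff_X_pow_mul', if_neg (not_le.mpr h)]

/-- `[X^d] (X g₁)^d = 1`. -/
theorem coeff_sArg_pow_self (d : ℕ) : coeff d (sArg ^ d) = 1 := by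
  rw [sArg, mul_pow, coeff_X_pow_mul', if_pos le_rfl, Nat.sub_self, coeff_zero_eq_constantCoeff_apply, map_pow,
    constantCoeff_geomInv, one_pow]

/-- Coefficients of `σF`: `[X^N] σF = Σ_{d ≤ N} [X^d]F · [X^N](X g₁)^d` (a finite sum since `ord (X g₁)^d = d`). -/
theorem coeff_sig (F : ℚ⟦X⟧) (N : ℕ) :
    coeff N (sig F) = ∑ d ∈ range (N + 1), coeff d F * coeff N (sArg ^ d) := by
  rw [sig_apply, coeff_subst' hasSubst_sArg, finsum_eq_sum_of_support_subset _ (s := range (N + 1))]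
  · simp only [smul_eq_mul]
  · rw [Function.support_subset_iff']
    intro d hd
    rw [mem_coe, mem_range, not_lt] at hd
    simp [coeff_sArg_pow_of_lt (Nat.lt_of_succ_le hd)]

/-- `g₁ = (1 − (−X))^{-1}` as a rescaled geometric series. -/
theorem geomInv_one_eq_rescale : geomInv 1 = rescale (-1 : ℚ) (mk 1) := by
  ext m; simp [coeff_rescale]

/-- Binomial series: `g₁^{n+1} = Σ_m (−1)^m binom(n+m, n) X^m`. -/
theorem geomInv_one_pow_succ (n : ℕ) :
    geomInv 1 ^ (n + 1) = mk fun m => (-1 : ℚ) ^ m * ((n + m).choose n : ℚ) := by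
  rw [geomInv_one_eq_rescale, ← map_pow, mk_one_pow_eq_mk_choose_add, rescale_mk]

/-- `[X^N] (X g₁)^{n+1} = (−1)^{N−n−1}·binom(N−1, n)` for `N ≥ n+1` (else `0`): the expansion of `1/(x^{n+1}(1+1/x)^{n+1})`. -/
theorem coeff_sArg_pow_succ (n N : ℕ) :
    coeff N (sArg ^ (n + 1)) = if n + 1 ≤ N then (-1 : ℚ) ^ (N - (n + 1)) * ((N - 1).choose n : ℚ) else 0 := by
  rw [sArg, mul_pow, coeff_X_pow_mul', geomInv_one_pow_succ]
  split_ifs with h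
  · have e : n + (N - (n + 1)) = N - 1 := by omega
    rw [coeff_mk, e]
  · rfl

/-- `σ` fixes natural-number scalars. -/
theorem sig_natCast (n : ℕ) : sig (n : ℚ⟦X⟧) = n := map_natCast sig n

/-- `σ g_i = (1+X)·g_{i+1}`  (`x/(x+i)` at `x+1` is `(x+1)/(x+1+i) = (1+X)/(1+(i+1)X)`). -/
theorem sig_geomInv (i : ℕ) : sig (geomInv i) = (1 + X) * geomInv (i + 1) := by
  have h1 : (1 + (i : ℚ⟦X⟧) * (X * geomInv 1)) * sig (geomInv i) = 1 := by
    have h := congrArg sig (one_add_mul_geomInv i)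
    rwa [map_mul, map_add, map_one, map_mul, map_natCast, sig_X] at h
  have h2 : (1 + X) * geomInv 1 = 1 := one_add_X_mul_geomInv_one
  have h3 : (1 + ((i : ℚ⟦X⟧) + 1) * X) * geomInv (i + 1) = 1 := by
    have h := one_add_mul_geomInv (i + 1)
    rwa [Nat.cast_succ] at h
  linear_combination (-(sig (geomInv i))) * h3 + (geomInv (i + 1) * (1 + X)) * h1
    - ((i : ℚ⟦X⟧) * X * sig (geomInv i) * geomInv (i + 1)) * h2

/-! ### The brackets `â_n`, `ê_n` and the shift relation -/

/-- `P_n := ∏_{i=1}^{n} g_i`, the expansion of `x^n/((x+1)⋯(x+n))`. -/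
def gProd (n : ℕ) : ℚ⟦X⟧ := ∏ i ∈ range n, geomInv (i + 1)

/-- `P_0 = 1`. -/
theorem gProd_zero : gProd 0 = 1 := by simp [gProd]

/-- `P_{n+1} = P_n·g_{n+1}`. -/
theorem gProd_succ (n : ℕ) : gProd (n + 1) = gProd n * geomInv (n + 1) := by
  rw [gProd, prod_range_succ]; rfl

/-- `g₁·σ(P_n) = (1+X)^n·P_{n+1}`. -/
theorem geomInv_one_mul_sig_gProd (n : ℕ) : geomInv 1 * sig (gProd n) = (1 + X) ^ n * gProd (n + 1) := by
  induction n with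
  | zero => simp [gProd_zero, gProd_succ]
  | succ n ih =>
    rw [gProd_succ n, map_mul, ← mul_assoc, ih, sig_geomInv, gProd_succ (n + 1)]
    ring

/-- `â_n := n!·X^{n+2}·g_n·P_n`, the expansion in `X = 1/x` of `a_n(x) = n!/(x(x+1)⋯(x+n)·(x+n))`. -/
def aHat (n : ℕ) : ℚ⟦X⟧ := (n ! : ℚ⟦X⟧) * X ^ (n + 2) * (geomInv n * gProd n)

/-- `ê_n := n!·X^{n+1}·P_n`, the expansion of `n!/(x(x+1)⋯(x+n))`. -/
def eHat (n : ℕ) : ℚ⟦X⟧ := (n ! : ℚ⟦X⟧) * X ^ (n + 1) * gProd n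

/-- `â_0 = X²` (`a_0(x) = 1/x²`). -/
theorem aHat_zero : aHat 0 = X ^ 2 := by simp [aHat, geomInv_zero, gProd_zero]

/-- The shift relation `a_{n+1}(x) + a_n(x+1) = (n!/(x)_{n+1} − (n+1)!/(x)_{n+2})/x`, formally:
`â_{n+1} + σ(â_n) = X·(ê_n − ê_{n+1})`. -/
theorem aHat_succ_add_sig_aHat (n : ℕ) : aHat (n + 1) + sig (aHat n) = X * (eHat n - eHat (n + 1)) := by
  have h2 : (1 + X) * geomInv 1 = 1 := one_add_X_mul_geomInv_one
  have hpow : geomInv 1 ^ (n + 1) * (1 + X) ^ (n + 1) = 1 := by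
    rw [← mul_pow, mul_comm, h2, one_pow]
  have hG : (1 + ((n : ℚ⟦X⟧) + 1) * X) * geomInv (n + 1) = 1 := by
    have h := one_add_mul_geomInv (n + 1)
    rwa [Nat.cast_succ] at h
  have hS : geomInv 1 * sig (gProd n) = (1 + X) ^ n * gProd (n + 1) := geomInv_one_mul_sig_gProd n
  have hP : gProd (n + 1) = gProd n * geomInv (n + 1) := gProd_succ n
  have hsig : sig (aHat n) =
      (n ! : ℚ⟦X⟧) * (X * geomInv 1) ^ (n + 2) * ((1 + X) * geomInv (n + 1) * sig (gProd n)) := by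
    rw [aHat, map_mul, map_mul, map_pow, map_mul, map_natCast, sig_X, sig_geomInv]
  have hfac : ((n + 1) ! : ℚ⟦X⟧) = ((n : ℚ⟦X⟧) + 1) * (n ! : ℚ⟦X⟧) := by
    rw [Nat.factorial_succ, Nat.cast_mul, Nat.cast_succ]
  rw [hsig, aHat, eHat, eHat, hfac]
  linear_combination ((n ! : ℚ⟦X⟧) * X ^ (n + 2) * geomInv 1 ^ (n + 1) * (1 + X) * geomInv (n + 1)) * hS
    + ((n ! : ℚ⟦X⟧) * X ^ (n + 2) * geomInv (n + 1) * gProd (n + 1)) * hpow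
    + ((n ! : ℚ⟦X⟧) * X ^ (n + 2) * (gProd (n + 1) + gProd n)) * hG
    + ((n ! : ℚ⟦X⟧) * X ^ (n + 2) * (1 + ((n : ℚ⟦X⟧) + 1) * X)) * hP

/-- `â_n` starts at `X^{n+2}`. -/
theorem coeff_aHat_of_lt {n N : ℕ} (h : N < n + 2) : coeff N (aHat n) = 0 := by
  rw [aHat, natCast_eq_C, mul_assoc, coeff_C_mul, coeff_X_pow_mul', if_neg (not_le.mpr h), mul_zero]

/-- `X·ê_n = n!·X^{n+2}·P_n`. -/
theorem X_mul_eHat (n : ℕ) : X * eHat n = (n ! : ℚ⟦X⟧) * X ^ (n + 2) * gProd n := by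
  rw [eHat]; ring

/-- `X·ê_n` starts at `X^{n+2}`. -/
theorem coeff_X_mul_eHat_of_lt {n N : ℕ} (h : N < n + 2) : coeff N (X * eHat n) = 0 := by
  rw [X_mul_eHat, natCast_eq_C, mul_assoc, coeff_C_mul, coeff_X_pow_mul', if_neg (not_le.mpr h), mul_zero]

/-- `X·ê_0 = X²`. -/
theorem X_mul_eHat_zero : X * eHat 0 = X ^ 2 := by
  rw [eHat, gProd_zero, Nat.factorial_zero, Nat.cast_one]; ring

/-! ### The coefficientwise sum `Â = Σ_n â_n` and `σÂ + Â = 2X²` -/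

/-- `σ` commutes with coefficientwise-finite sums: if `[X^N](F n) = 0` whenever `N < n`, then
`[X^N] σ(Σ_n F n) = Σ_{n ≤ N} [X^N] σ(F n)`, where `Σ_n F n := mk (N ↦ Σ_{n ≤ N} [X^N] F n)`. -/
theorem coeff_sig_mk_sum (F : ℕ → ℚ⟦X⟧) (hF : ∀ n N, N < n → coeff N (F n) = 0) (N : ℕ) :
    coeff N (sig (mk fun M => ∑ n ∈ range (M + 1), coeff M (F n))) = ∑ n ∈ range (N + 1), coeff N (sig (F n)) := by
  rw [coeff_sig]
  simp only [coeff_mk, coeff_sig]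
  calc ∑ d ∈ range (N + 1), (∑ n ∈ range (d + 1), coeff d (F n)) * coeff N (sArg ^ d)
      = ∑ d ∈ range (N + 1), ∑ n ∈ range (N + 1), coeff d (F n) * coeff N (sArg ^ d) := by
        refine sum_congr rfl fun d hd => ?_
        rw [sum_mul]
        apply sum_subset
        · exact range_subset_range.mpr (Nat.succ_le_succ (Nat.lt_succ_iff.mp (mem_range.mp hd)))
        · intro n _ hnd
          rw [mem_range, not_lt] at hnd
          rw [hF n d (Nat.lt_of_succ_le hnd), zero_mul]
    _ = ∑ n ∈ range (N + 1), ∑ d ∈ range (N + 1), coeff d (F n) * coeff N (sArg ^ d) := sum_comm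

/-- `Â := Σ_n â_n`, summed coefficientwise (for each `N` only `n ≤ N − 2` contribute) — the expansion of `A(x) = Σ_n a_n(x)`. -/
def AHat : ℚ⟦X⟧ := mk fun N => ∑ n ∈ range (N + 1), coeff N (aHat n)

/-- Coefficients of `Â`. -/
theorem coeff_AHat (N : ℕ) : coeff N AHat = ∑ n ∈ range (N + 1), coeff N (aHat n) := coeff_mk _ _

/-- `σ(â_N)` has no `X^N` term. -/
theorem coeff_sig_aHat_self (N : ℕ) : coeff N (sig (aHat N)) = 0 := by
  rw [coeff_sig]
  exact sum_eq_zero fun d hd => by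
    rw [coeff_aHat_of_lt (by have := mem_range.mp hd; omega), zero_mul]

/-- **`A(x+1) + A(x) = 2/x²`, formally:** `σÂ + Â = 2X²` (the shift relation telescopes). -/
theorem sig_AHat_add_AHat : sig AHat + AHat = 2 * X ^ 2 := by
  ext N
  rw [map_add, AHat, coeff_sig_mk_sum aHat (fun n N h => coeff_aHat_of_lt (by omega)) N, coeff_mk]
  have h1 : ∑ n ∈ range (N + 1), coeff N (sig (aHat n)) = ∑ n ∈ range N, coeff N (sig (aHat n)) := by
    rw [sum_range_succ, coeff_sig_aHat_self, add_zero]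
  have h2 : ∑ n ∈ range (N + 1), coeff N (aHat n) = ∑ n ∈ range N, coeff N (aHat (n + 1)) + coeff N (aHat 0) :=
    sum_range_succ' _ _
  have htel : ∑ n ∈ range N, coeff N (sig (aHat n)) + ∑ n ∈ range N, coeff N (aHat (n + 1)) =
      coeff N (X * eHat 0) - coeff N (X * eHat N) := by
    rw [← sum_add_distrib]
    have e : ∀ n, coeff N (sig (aHat n)) + coeff N (aHat (n + 1)) = coeff N (X * eHat n) - coeff N (X * eHat (n + 1)) :=
      fun n => by rw [← map_add, ← map_sub, add_comm, aHat_succ_add_sig_aHat, mul_sub]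
    simp_rw [e]
    exact sum_range_sub' (fun n => coeff N (X * eHat n)) N
  rw [h1, h2, ← add_assoc, htel, coeff_X_mul_eHat_of_lt (by omega : N < N + 2), X_mul_eHat_zero, aHat_zero, sub_zero,
    two_mul, map_add]

/-! ### The Genocchi side `Φ` and `σΦ + Φ = 2X²` -/

/-- Coefficients of `Φ`: `φ₀ = 0`, `φ_{k+1} = G_k·(−1)^{k+1}`. -/
def phiCoeff : ℕ → ℚ
  | 0 => 0
  | k + 1 => genocchi k * (-1) ^ (k + 1)

/-- `φ₀ = 0`. -/
@[simp] theorem phiCoeff_zero : phiCoeff 0 = 0 := rfl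

/-- `φ_{k+1} = G_k (−1)^{k+1}`. -/
@[simp] theorem phiCoeff_succ (k : ℕ) : phiCoeff (k + 1) = genocchi k * (-1) ^ (k + 1) := rfl

/-- `Φ := Σ_{k≥0} G_k (−1)^{k+1} X^{k+1}` — the expansion in `X = 1/x` of `−Θ(x)`, `Θ(x) := Σ_k (2^{k+1}−2)·B_k/(−x)^{k+1}`
([Be08], the function `Θ` for `p = 2`; note `(2^{k+1}−2)B_k = −G_k`). -/
def Phi : ℚ⟦X⟧ := mk phiCoeff

/-- Coefficients of `Φ`. -/
theorem coeff_Phi (N : ℕ) : coeff N Phi = phiCoeff N := coeff_mk _ _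

/-- **`Θ(x+1) + Θ(x) = −2/x²` (via the Genocchi recurrence), formally:** `σΦ + Φ = 2X²`. -/
theorem sig_Phi_add_Phi : sig Phi + Phi = 2 * X ^ 2 := by
  ext N
  rw [map_add, coeff_sig, two_mul, map_add, coeff_X_pow]
  simp only [coeff_Phi]
  cases N with
  | zero => simp
  | succ M =>
    rw [sum_range_succ', phiCoeff_zero, zero_mul, add_zero]
    have hsum : ∑ k ∈ range (M + 1), phiCoeff (k + 1) * coeff (M + 1) (sArg ^ (k + 1)) =
        (-1) ^ (M + 1) * ∑ k ∈ range (M + 1), (M.choose k : ℚ) * genocchi k := by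
      rw [mul_sum]
      refine sum_congr rfl fun k hk => ?_
      have hkM : k ≤ M := Nat.lt_succ_iff.mp (mem_range.mp hk)
      rw [phiCoeff_succ, coeff_sArg_pow_succ, if_pos (by omega), show M + 1 - (k + 1) = M - k by omega,
        show M + 1 - 1 = M by omega]
      have e : (-1 : ℚ) ^ (k + 1) * (-1) ^ (M - k) = (-1) ^ (M + 1) := by
        rw [← pow_add]; congr 1; omega
      calc genocchi k * (-1) ^ (k + 1) * ((-1 : ℚ) ^ (M - k) * (M.choose k : ℚ))
          = ((-1 : ℚ) ^ (k + 1) * (-1) ^ (M - k)) * ((M.choose k : ℚ) * genocchi k) := by ring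
        _ = (-1) ^ (M + 1) * ((M.choose k : ℚ) * genocchi k) := by rw [e]
    rw [hsum, phiCoeff_succ, show genocchi M * (-1 : ℚ) ^ (M + 1) = (-1) ^ (M + 1) * genocchi M by ring, ← mul_add,
      genocchi_recurrence M]
    by_cases hM : M = 1
    · subst hM; norm_num
    · rw [if_neg hM, if_neg (show M + 1 ≠ 2 by omega), mul_zero, add_zero]

/-! ### Beukers' Lemma 5 and the identification `Â = Φ` -/

/-- **Beukers' Lemma 5, formal version:** a power series with `F(X/(1+X)) = −F(X)` vanishes
(the lowest coefficient of `σF` equals that of `F`, so it would have to be its own negative). -/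
theorem eq_zero_of_sig_add_self_eq_zero {F : ℚ⟦X⟧} (h : sig F + F = 0) : F = 0 := by
  ext m
  rw [map_zero]
  induction m using Nat.strong_induction_on with
  | _ m ih =>
    have hm := congrArg (coeff m) h
    have hz : ∑ d ∈ range m, coeff d F * coeff m (sArg ^ d) = 0 :=
      sum_eq_zero fun d hd => by rw [ih d (mem_range.mp hd), zero_mul]
    rw [map_add, map_zero, coeff_sig, sum_range_succ, coeff_sArg_pow_self, mul_one, hz, zero_add] at hm
    linarith

/-- **`Â = Φ`** (`A = −Θ` of `families/denom/K5B.md` Lemma A): both solve `σF + F = 2X²`, and the difference is killed by Lemma 5. -/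
theorem AHat_eq_Phi : AHat = Phi := by
  have h : sig (AHat - Phi) + (AHat - Phi) = 0 := by
    rw [map_sub]
    linear_combination sig_AHat_add_AHat - sig_Phi_add_Phi
  exact sub_eq_zero.mp (eq_zero_of_sig_add_self_eq_zero h)

/-- Coefficientwise form of `Â = Φ`: `Σ_{n ≤ N} [X^N] â_n = φ_N` (`= G_{N−1}(−1)^N` for `N ≥ 1`, and `0` for `N = 0`). -/
theorem sum_coeff_aHat (N : ℕ) : ∑ n ∈ range (N + 1), coeff N (aHat n) = phiCoeff N := by
  rw [← coeff_AHat, AHat_eq_Phi, coeff_Phi]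

/-- Sanity (kernel arithmetic on the first coefficients): `φ₁, φ₂, φ₃ = 0·(−1), 1, 1`, matching
`â_0 = X²` (coefficient `1` at `X²`) and `[X³](â_0 + â_1) = 0 + 1`. -/
example : phiCoeff 2 = 1 ∧ phiCoeff 3 = 1 := by
  refine ⟨?_, ?_⟩
  · rw [phiCoeff_succ, CatalanTwoAdicGenocchi.genocchi_one]; norm_num
  · rw [phiCoeff_succ, CatalanTwoAdicGenocchi.genocchi_two]; norm_num

end Summit.KontsevichZagierPeriods.Zeta5Search.CatalanTwoAdicFactorialSeries

end
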